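import Mathlib.Algebra.BigOperators.Module
import Mathlib.Analysis.SpecialFunctions.Trigonometric.Bounds
import Literature.NumberTheory.LFunctions.WeilWindowCertifiedProfile
import Literature.NumberTheory.LFunctions.RHWave0PNTProofs
import Literature.NumberTheory.DiophantineApproximation.SimultaneousDirichlet
import HarnessLib

/-!
# RH-FREE (Chuk 2026, Thm 3 / Lemma 6: the prime-comb asymptotics), PROVED — «nothing here bears on the truth of RH»
# `A_L = (4 + o(1)) e^L` and `sup_t P_L(t) = A_L` approached at arbitrarily large `t`: discharge of `Chuk2026_thm3`

M. Chuk, *Weil positivity in compact windows: certified two-sided bounds and a Landau–Widom decay law*,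
arXiv:2608.24827v1 (Aug 2026) [`Chuk2026WeilWindows`; PREPRINT, unrefereed], **Theorem 3 (Barrier)** and **Lemma 6**,
the two asymptotic clauses typed as the named fact `Chuk2026_thm3` of `WeilWindowCertifiedProfile.lean` (RH literature-
typing tranche 1): (i) «`A_L = (4 + o(1))e^L` by the prime number theorem» for the comb mass
`A_L = Σ_{log n < 2L} 2Λ(n)/√n` (`weilCombMass L`), and (ii) «the supremum [`A_L` of the prime comb
`P_L(t) = Σ_{log n < 2L} 2Λ(n) n^{-1/2} cos(t log n)`] is approached at arbitrarily large `t`» (Lemma 6; the paper says «Weyl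
equidistribution»). DISCHARGED here: `Chuk2026_thm3_holds`. Both clauses are RH-FREE elementary analytic number theory
(PNT by partial summation; Dirichlet's simultaneous approximation); nothing in this file is, or is worded as, progress toward
RH — the clauses only say that pointwise comb bounds cannot lower the paper's resolution threshold `T₁ = 2πe^{A_L}`.
Theorems only: no definitions, no named facts (D-0014/D-0026).

## Proof (the paper's one-line justifications, made explicit)

* (i) With `N = ⌈e^{2L}⌉ − 1` (`weilWindowCutoff L`, so `e^{2L} − 1 ≤ N ≤ e^{2L}`), `A_L = 2 Σ_{n ≤ N} Λ(n)/√n`, and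
  `Σ_{n ≤ N} Λ(n)/√n ~ 2√N` (`Chuk2026Thm3.tendsto_sum_vonMangoldt_div_sqrt`): by Abel summation
  (`Finset.sum_range_by_parts`) against `1/√n`, `Σ_{n ≤ N} (Λ(n) − 1)/√n = (ψ(N) − N − 1)/√N + Σ_{i < N} (1/√i − 1/√(i+1))(ψ(i) − i − 1)`
  `= o(√N)` from `ψ(x) ~ x` (the tree's `chebyshevPsi_isEquivalent_holds`, PNT) and `Σ_{i<N} i(1/√i − 1/√(i+1)) ≤ Σ_{i<N} 1/√i`,
  while `2√(N+1) − 2 ≤ Σ_{1 ≤ n ≤ N} 1/√n ≤ 2√N`. Hence `A_L/e^L = 2 · (Σ/√N) · (√N/e^L) → 2 · 2 · 1 = 4`.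
* (ii) Dirichlet's theorem on simultaneous approximation (the tree's
  `DiophantineApproximation.exists_forall_abs_natCast_mul_sub_intCast_lt`, Hardy–Wright Thm 200) applied to
  `αₙ = T' log n/(2π)`, `n ≤ N`, `T' = max(T, 1)`: an integer `q ≥ 1` with `|q αₙ − pₙ| < 1/Q`; at `t = qT' ≥ T`,
  `cos(t log n) = cos(2π(qαₙ − pₙ)) ≥ 1 − 2π²/Q²`, so `P_L(t) ≥ A_L(1 − 2π²/Q²) > A_L − ε` for `Q` large. (The paper invokes
  Weyl/Kronecker and the `ℚ`-linear independence of `{log p}`; for approaching the value at `t = 0` Dirichlet suffices and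
  needs no independence.)

## References
* [Chuk2026WeilWindows] M. Chuk, arXiv:2608.24827v1, Thm 3 and Lemma 6 (with §1, definition of `A_L`, eq. (3)).
* [HardyWright2008] G. H. Hardy, E. M. Wright, 6th ed., §11.12 Thm 200 (Dirichlet's simultaneous approximation).
-/

noncomputable section

open Filter Topology Asymptotics
open scoped Real ArithmeticFunction.vonMangoldt

namespace Literature.NumberTheory.LFunctions

namespace Chuk2026Thm3

/-! ### `Σ_{1 ≤ n ≤ N} 1/√n` is between `2√(N+1) − 2` and `2√N` -/

/-- `Σ_{n ≤ N} 1/√n ≤ 2√N` (the `n = 0` term is `1/√0 = 0`). [folklore] -/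
private theorem sum_inv_sqrt_le (N : ℕ) :
    ∑ i ∈ Finset.range (N + 1), 1 / Real.sqrt i ≤ 2 * Real.sqrt N := by
  induction N with
  | zero => simp
  | succ m ih =>
    rw [Finset.sum_range_succ]
    have hm : (0 : ℝ) ≤ m := Nat.cast_nonneg m
    set s : ℝ := Real.sqrt ((m + 1 : ℕ) : ℝ) with hs
    set r : ℝ := Real.sqrt (m : ℝ) with hr
    have hs0 : 0 < s := Real.sqrt_pos.2 (by positivity)
    have hr0 : 0 ≤ r := Real.sqrt_nonneg _
    have hs2 : s ^ 2 = (m : ℝ) + 1 := by rw [hs, Real.sq_sqrt (by positivity)]; push_cast; ring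
    have hr2 : r ^ 2 = (m : ℝ) := by rw [hr, Real.sq_sqrt hm]
    have hrs : r ≤ s := Real.sqrt_le_sqrt (by push_cast; linarith)
    have hprod : (s - r) * (s + r) = 1 := by nlinarith
    have key : 1 / s ≤ 2 * (s - r) := by
      rw [div_le_iff₀ hs0]
      nlinarith
    linarith

/-- `2√(N+1) − 2 ≤ Σ_{n ≤ N} 1/√n`. [folklore] -/
private theorem le_sum_inv_sqrt (N : ℕ) :
    2 * Real.sqrt ((N : ℝ) + 1) - 2 ≤ ∑ i ∈ Finset.range (N + 1), 1 / Real.sqrt i := by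
  induction N with
  | zero => simp
  | succ m ih =>
    rw [Finset.sum_range_succ]
    have hm : (0 : ℝ) ≤ m := Nat.cast_nonneg m
    push_cast
    set s : ℝ := Real.sqrt ((m : ℝ) + 1 + 1) with hs
    set u : ℝ := Real.sqrt ((m : ℝ) + 1) with hu
    have hu0 : 0 < u := Real.sqrt_pos.2 (by positivity)
    have hs0 : 0 ≤ s := Real.sqrt_nonneg _
    have hs2 : s ^ 2 = (m : ℝ) + 1 + 1 := by rw [hs, Real.sq_sqrt (by positivity)]
    have hu2 : u ^ 2 = (m : ℝ) + 1 := by rw [hu, Real.sq_sqrt (by positivity)]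
    have hus : u ≤ s := Real.sqrt_le_sqrt (by linarith)
    have hprod : (s - u) * (s + u) = 1 := by nlinarith
    have key : 2 * (s - u) ≤ 1 / u := by
      rw [le_div_iff₀ hu0]
      nlinarith [mul_nonneg (sub_nonneg.2 hus) (sub_nonneg.2 hus)]
    linarith

/-- `(Σ_{n ≤ N} 1/√n)/√N → 2`. [folklore] -/
private theorem tendsto_sum_inv_sqrt_div :
    Tendsto (fun N : ℕ ↦ (∑ i ∈ Finset.range (N + 1), 1 / Real.sqrt i) / Real.sqrt N) atTop (𝓝 2) := by
  have hsqrt : Tendsto (fun N : ℕ ↦ Real.sqrt (N : ℝ)) atTop atTop :=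
    Real.tendsto_sqrt_atTop.comp tendsto_natCast_atTop_atTop
  have hlow : Tendsto (fun N : ℕ ↦ (2 : ℝ) - 2 * (Real.sqrt (N : ℝ))⁻¹) atTop (𝓝 2) := by
    have h1 := (tendsto_inv_atTop_zero.comp hsqrt).const_mul (2 : ℝ)
    rw [mul_zero] at h1
    have h2 := h1.const_sub (2 : ℝ)
    rw [sub_zero] at h2
    exact h2
  refine tendsto_of_tendsto_of_tendsto_of_le_of_le' hlow tendsto_const_nhds ?_ ?_
  · filter_upwards [eventually_ge_atTop 1] with N hN
    have hN0 : (0 : ℝ) < N := by exact_mod_cast hN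
    have hsN : 0 < Real.sqrt (N : ℝ) := Real.sqrt_pos.2 hN0
    have hl := le_sum_inv_sqrt N
    have hmono : Real.sqrt (N : ℝ) ≤ Real.sqrt ((N : ℝ) + 1) := Real.sqrt_le_sqrt (by linarith)
    rw [le_div_iff₀ hsN, sub_mul, mul_assoc, inv_mul_cancel₀ hsN.ne', mul_one]
    linarith
  · filter_upwards [eventually_ge_atTop 1] with N hN
    have hN0 : (0 : ℝ) < N := by exact_mod_cast hN
    have hsN : 0 < Real.sqrt (N : ℝ) := Real.sqrt_pos.2 hN0
    rw [div_le_iff₀ hsN]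
    exact sum_inv_sqrt_le N

/-! ### Abel summation against `1/√n` and the prime number theorem -/

/-- `Σ_{i < N} i (1/√i − 1/√(i+1)) = Σ_{i < N} 1/√i − (N − 1)/√N` (telescoping). [folklore] -/
private theorem sum_mul_diff_eq (N : ℕ) :
    ∑ i ∈ Finset.range N, (1 / Real.sqrt i - 1 / Real.sqrt ((i + 1 : ℕ) : ℝ)) * i =
      (∑ i ∈ Finset.range N, 1 / Real.sqrt i) - ((N : ℝ) - 1) * (1 / Real.sqrt N) := by
  induction N with
  | zero => simp
  | succ m ih =>
    rw [Finset.sum_range_succ, Finset.sum_range_succ, ih]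
    push_cast
    ring

/-- `Σ_{i < N} |1/√(i+1) − 1/√i| ≤ 2` (it is `1 + (1 − 1/√N)` for `N ≥ 1`: the `i = 0` term is `|1 − 0| = 1`). [folklore] -/
private theorem sum_abs_diff_le (N : ℕ) :
    ∑ i ∈ Finset.range N, |1 / Real.sqrt ((i + 1 : ℕ) : ℝ) - 1 / Real.sqrt i| ≤ 2 := by
  rcases Nat.eq_zero_or_pos N with rfl | hN
  · simp
  · -- for `N ≥ 1` the sum equals `2 − 1/√N`
    have key : ∀ M : ℕ, ∑ i ∈ Finset.range (M + 1), |1 / Real.sqrt ((i + 1 : ℕ) : ℝ) - 1 / Real.sqrt i| =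
        2 - 1 / Real.sqrt ((M + 1 : ℕ) : ℝ) := by
      intro M
      induction M with
      | zero => simp; norm_num
      | succ m ih =>
        rw [Finset.sum_range_succ, ih]
        have h1 : (0 : ℝ) < ((m + 1 : ℕ) : ℝ) := by positivity
        have h2 : ((m + 1 : ℕ) : ℝ) ≤ ((m + 1 + 1 : ℕ) : ℝ) := by push_cast; linarith
        have hle : 1 / Real.sqrt ((m + 1 + 1 : ℕ) : ℝ) ≤ 1 / Real.sqrt ((m + 1 : ℕ) : ℝ) :=
          one_div_le_one_div_of_le (Real.sqrt_pos.2 h1) (Real.sqrt_le_sqrt h2)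
        rw [abs_of_nonpos (by linarith)]
        ring
    obtain ⟨M, rfl⟩ : ∃ M, N = M + 1 := ⟨N - 1, by omega⟩
    rw [key M]
    have : 0 ≤ 1 / Real.sqrt ((M + 1 : ℕ) : ℝ) := by positivity
    linarith

/-- **`Σ_{n ≤ N} (Λ(n) − 1)/√n = o(√N)`** (prime number theorem `ψ(x) ~ x` and Abel summation against `1/√n`).
[cite: Chuk2026WeilWindows, Thm 3 («by the prime number theorem»)] -/
private theorem tendsto_sum_sub_div_sqrt :
    Tendsto (fun N : ℕ ↦ (∑ i ∈ Finset.range (N + 1), (Λ i : ℝ) / Real.sqrt i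
      - ∑ i ∈ Finset.range (N + 1), 1 / Real.sqrt i) / Real.sqrt N) atTop (𝓝 0) := by
  -- PNT along the integers: `ψ(k) − k = o(k)`
  have hPNT : (fun k : ℕ ↦ Chebyshev.psi k - k) =o[atTop] fun k : ℕ ↦ (k : ℝ) := by
    have h := chebyshevPsi_isEquivalent_holds
    unfold chebyshevPsi_isEquivalent at h
    exact h.isLittleO.comp_tendsto tendsto_natCast_atTop_atTop
  -- `ψ(k) = Σ_{j ≤ k} Λ(j)`
  have hpsi : ∀ k : ℕ, ∑ j ∈ Finset.range (k + 1), (Λ j : ℝ) = Chebyshev.psi k := by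
    intro k
    rw [Chebyshev.psi_eq_sum_Icc, Nat.floor_natCast, Nat.range_succ_eq_Icc_zero]
  rw [Metric.tendsto_atTop]
  intro ε hε
  -- `|ψ(k) − k| ≤ (ε/4) k` for `k ≥ K`, and `≤ (ε/4) k + C` for all `k`
  set E : ℕ → ℝ := fun k ↦ Chebyshev.psi k - k with hE_def
  have hε4 : 0 < ε / 4 := by positivity
  obtain ⟨K, hK⟩ := eventually_atTop.1 (hPNT.def hε4)
  set C : ℝ := ∑ k ∈ Finset.range K, |E k| with hC_def
  have hC0 : 0 ≤ C := Finset.sum_nonneg fun k _ ↦ abs_nonneg _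
  have hEall : ∀ k : ℕ, |E k| ≤ ε / 4 * k + C := by
    intro k
    rcases lt_or_ge k K with hk | hk
    · have h1 : |E k| ≤ C := by
        rw [hC_def]
        exact Finset.single_le_sum (f := fun k ↦ |E k|) (fun k _ ↦ abs_nonneg _) (Finset.mem_range.2 hk)
      have h2 : 0 ≤ ε / 4 * k := by positivity
      linarith
    · have h1 := hK k hk
      rw [Real.norm_eq_abs, Real.norm_eq_abs, Nat.abs_cast] at h1
      linarith
  -- the threshold
  obtain ⟨N₀, hN₀⟩ : ∃ N₀ : ℕ, ((12 * (C + 1) / ε) ^ 2 : ℝ) < N₀ := exists_nat_gt _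
  refine ⟨max N₀ 1, fun N hN ↦ ?_⟩
  have hN1 : 1 ≤ N := le_trans (le_max_right _ _) hN
  have hNN₀ : N₀ ≤ N := le_trans (le_max_left _ _) hN
  have hN0 : (0 : ℝ) < N := by exact_mod_cast hN1
  have hsN : 0 < Real.sqrt (N : ℝ) := Real.sqrt_pos.2 hN0
  -- notation
  set f : ℕ → ℝ := fun i ↦ 1 / Real.sqrt i with hf_def
  set g : ℕ → ℝ := fun i ↦ (Λ i : ℝ) - 1 with hg_def
  have hfg : ∀ i, (Λ i : ℝ) / Real.sqrt i - 1 / Real.sqrt i = f i • g i := by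
    intro i
    simp only [hf_def, hg_def, smul_eq_mul]
    ring
  have hG : ∀ k : ℕ, ∑ j ∈ Finset.range (k + 1), g j = E k - 1 := by
    intro k
    simp only [hg_def, hE_def, Finset.sum_sub_distrib, hpsi k, Finset.sum_const, Finset.card_range]
    ring
  -- Abel summation
  have hAbel : ∑ i ∈ Finset.range (N + 1), (Λ i : ℝ) / Real.sqrt i - ∑ i ∈ Finset.range (N + 1), 1 / Real.sqrt i
      = f N * (E N - 1) - ∑ i ∈ Finset.range N, (f (i + 1) - f i) * (E i - 1) := by
    rw [← Finset.sum_sub_distrib]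
    simp_rw [hfg]
    rw [Finset.sum_range_by_parts]
    simp only [add_tsub_cancel_right, hG, smul_eq_mul]
  -- the bounds
  have hf0 : ∀ i, 0 ≤ f i := fun i ↦ by simp only [hf_def]; positivity
  have hfN : f N = 1 / Real.sqrt N := rfl
  have hfN1 : f N ≤ 1 := by
    rw [hfN, div_le_one hsN]
    have : (1 : ℝ) ≤ N := by exact_mod_cast hN1
    calc (1 : ℝ) = Real.sqrt 1 := Real.sqrt_one.symm
      _ ≤ Real.sqrt N := Real.sqrt_le_sqrt this
  have hfNN : f N * N = Real.sqrt N := by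
    rw [hfN]
    field_simp
    rw [Real.sq_sqrt hN0.le]
  -- first term
  have h1 : |f N * (E N - 1)| ≤ ε / 4 * Real.sqrt N + (C + 1) := by
    rw [abs_mul, abs_of_nonneg (hf0 N)]
    have hE1 : |E N - 1| ≤ ε / 4 * N + C + 1 := by
      have := abs_sub_le (E N) 0 1
      simp only [sub_zero, zero_sub, abs_neg, abs_one] at this
      linarith [hEall N]
    calc f N * |E N - 1| ≤ f N * (ε / 4 * N + C + 1) := mul_le_mul_of_nonneg_left hE1 (hf0 N)
      _ = ε / 4 * (f N * N) + f N * (C + 1) := by ring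
      _ ≤ ε / 4 * Real.sqrt N + 1 * (C + 1) := by
          rw [hfNN]
          gcongr
      _ = ε / 4 * Real.sqrt N + (C + 1) := by ring
  -- second term
  have h2 : |∑ i ∈ Finset.range N, (f (i + 1) - f i) * (E i - 1)| ≤ ε / 4 * (2 * Real.sqrt N) + 2 * (C + 1) := by
    have hdiff : ∀ i : ℕ, |f (i + 1) - f i| * (i : ℝ) = (f i - f (i + 1)) * i := by
      intro i
      rcases Nat.eq_zero_or_pos i with rfl | hi
      · simp
      · have hi0 : (0 : ℝ) < i := by exact_mod_cast hi
        have hle : f (i + 1) ≤ f i := by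
          simp only [hf_def]
          exact one_div_le_one_div_of_le (Real.sqrt_pos.2 hi0)
            (Real.sqrt_le_sqrt (by push_cast; linarith))
        rw [abs_of_nonpos (by linarith)]
        ring
    calc |∑ i ∈ Finset.range N, (f (i + 1) - f i) * (E i - 1)|
        ≤ ∑ i ∈ Finset.range N, |(f (i + 1) - f i) * (E i - 1)| := Finset.abs_sum_le_sum_abs _ _
      _ ≤ ∑ i ∈ Finset.range N, |f (i + 1) - f i| * (ε / 4 * i + C + 1) := by
          refine Finset.sum_le_sum fun i _ ↦ ?_
          rw [abs_mul]
          refine mul_le_mul_of_nonneg_left ?_ (abs_nonneg _)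
          have := abs_sub_le (E i) 0 1
          simp only [sub_zero, zero_sub, abs_neg, abs_one] at this
          linarith [hEall i]
      _ = ε / 4 * ∑ i ∈ Finset.range N, (f i - f (i + 1)) * i
            + (C + 1) * ∑ i ∈ Finset.range N, |f (i + 1) - f i| := by
          rw [Finset.mul_sum, Finset.mul_sum, ← Finset.sum_add_distrib]
          refine Finset.sum_congr rfl fun i _ ↦ ?_
          rw [← hdiff i]
          ring
      _ ≤ ε / 4 * (2 * Real.sqrt N) + (C + 1) * 2 := by
          gcongr
          · -- `Σ_{i<N} i (f i − f (i+1)) = Σ_{i<N} f i − (N−1) f N ≤ Σ_{i ≤ N} f i ≤ 2√N`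
            have hid := sum_mul_diff_eq N
            simp only [hf_def]
            rw [hid]
            have hnn : 0 ≤ ((N : ℝ) - 1) * (1 / Real.sqrt N) :=
              mul_nonneg (by linarith [(show (1 : ℝ) ≤ N by exact_mod_cast hN1)]) (by positivity)
            have hmono : ∑ i ∈ Finset.range N, 1 / Real.sqrt (i : ℝ) ≤ ∑ i ∈ Finset.range (N + 1), 1 / Real.sqrt (i : ℝ) :=
              Finset.sum_le_sum_of_subset_of_nonneg (Finset.range_subset_range.2 (Nat.le_succ N))
                fun i _ _ ↦ by positivity
            linarith [sum_inv_sqrt_le N]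
          · simp only [hf_def]
            exact sum_abs_diff_le N
      _ = ε / 4 * (2 * Real.sqrt N) + 2 * (C + 1) := by ring
  -- conclusion
  rw [Real.dist_eq, sub_zero, hAbel, abs_div, abs_of_pos hsN, div_lt_iff₀ hsN]
  have h3 : |f N * (E N - 1) - ∑ i ∈ Finset.range N, (f (i + 1) - f i) * (E i - 1)|
      ≤ 3 * ε / 4 * Real.sqrt N + 3 * (C + 1) := by
    have := abs_sub (f N * (E N - 1)) (∑ i ∈ Finset.range N, (f (i + 1) - f i) * (E i - 1))
    linarith
  -- `3(C+1) < (ε/4)√N` since `√N > 12(C+1)/ε`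
  have hbig : 12 * (C + 1) / ε < Real.sqrt N := by
    have hN₀' : ((12 * (C + 1) / ε) ^ 2 : ℝ) < N := lt_of_lt_of_le hN₀ (by exact_mod_cast hNN₀)
    have hpos : 0 ≤ 12 * (C + 1) / ε := by positivity
    calc 12 * (C + 1) / ε = Real.sqrt ((12 * (C + 1) / ε) ^ 2) := (Real.sqrt_sq hpos).symm
      _ < Real.sqrt N := Real.sqrt_lt_sqrt (sq_nonneg _) hN₀'
  have h4 : 3 * (C + 1) < ε / 4 * Real.sqrt N := by
    rw [div_lt_iff₀ hε] at hbig
    linarith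
  linarith

/-- **`(Σ_{n ≤ N} Λ(n)/√n)/√N → 2`**, i.e. `Σ_{n ≤ x} Λ(n) n^{-1/2} ~ 2√x` — the prime number theorem by partial summation.
[cite: Chuk2026WeilWindows, Thm 3 («`A_L = (4 + o(1))e^L` by the prime number theorem»)] -/
theorem tendsto_sum_vonMangoldt_div_sqrt :
    Tendsto (fun N : ℕ ↦ (∑ i ∈ Finset.range (N + 1), (Λ i : ℝ) / Real.sqrt i) / Real.sqrt N) atTop (𝓝 2) := by
  have h := tendsto_sum_sub_div_sqrt.add tendsto_sum_inv_sqrt_div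
  rw [zero_add] at h
  refine h.congr' ?_
  filter_upwards [eventually_ge_atTop 1] with N hN
  rw [← add_div]
  ring

/-! ### Clause (i): `A_L/e^L → 4` -/

/-- `N_L = ⌈e^{2L}⌉ − 1 → ∞`. [cite: Chuk2026WeilWindows, §1 eq. (3)] -/
private theorem tendsto_weilWindowCutoff : Tendsto weilWindowCutoff atTop atTop := by
  unfold weilWindowCutoff
  refine (tendsto_sub_atTop_nat 1).comp ?_
  refine tendsto_nat_ceil_atTop.comp ?_
  exact Real.tendsto_exp_atTop.comp (tendsto_id.const_mul_atTop (by norm_num : (0 : ℝ) < 2))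

/-- `√N_L / e^L → 1` (`e^{2L} − 1 ≤ N_L ≤ e^{2L}`). [cite: Chuk2026WeilWindows, §1 eq. (3)] -/
private theorem tendsto_sqrt_weilWindowCutoff_div_exp :
    Tendsto (fun L : ℝ ↦ Real.sqrt (weilWindowCutoff L) / Real.exp L) atTop (𝓝 1) := by
  -- `N_L / e^{2L} → 1`
  have hratio : Tendsto (fun L : ℝ ↦ (weilWindowCutoff L : ℝ) / Real.exp (2 * L)) atTop (𝓝 1) := by
    have hlow : Tendsto (fun L : ℝ ↦ 1 - (Real.exp (2 * L))⁻¹) atTop (𝓝 1) := by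
      have h1 : Tendsto (fun L : ℝ ↦ (Real.exp (2 * L))⁻¹) atTop (𝓝 0) :=
        tendsto_inv_atTop_zero.comp
          (Real.tendsto_exp_atTop.comp (tendsto_id.const_mul_atTop (by norm_num : (0 : ℝ) < 2)))
      have h2 := h1.const_sub (1 : ℝ)
      rw [sub_zero] at h2
      exact h2
    refine tendsto_of_tendsto_of_tendsto_of_le_of_le' hlow tendsto_const_nhds ?_ ?_
    · filter_upwards [eventually_ge_atTop 0] with L hL
      have hexp : 0 < Real.exp (2 * L) := Real.exp_pos _
      have h1e : 1 ≤ Real.exp (2 * L) := Real.one_le_exp (by linarith)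
      rw [le_div_iff₀ hexp, sub_mul, inv_mul_cancel₀ hexp.ne', one_mul]
      -- `e^{2L} − 1 ≤ ⌈e^{2L}⌉ − 1`
      have hceil : 1 ≤ ⌈Real.exp (2 * L)⌉₊ := Nat.one_le_iff_ne_zero.2 (Nat.ceil_pos.2 hexp).ne'
      unfold weilWindowCutoff
      rw [Nat.cast_sub hceil, Nat.cast_one]
      linarith [Nat.le_ceil (Real.exp (2 * L))]
    · filter_upwards [eventually_ge_atTop 0] with L hL
      have hexp : 0 < Real.exp (2 * L) := Real.exp_pos _
      rw [div_le_one hexp]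
      have hceil : 1 ≤ ⌈Real.exp (2 * L)⌉₊ := Nat.one_le_iff_ne_zero.2 (Nat.ceil_pos.2 hexp).ne'
      unfold weilWindowCutoff
      rw [Nat.cast_sub hceil, Nat.cast_one]
      linarith [Nat.ceil_lt_add_one hexp.le]
  have hsqrt := (Real.continuous_sqrt.tendsto 1).comp hratio
  rw [Real.sqrt_one] at hsqrt
  refine hsqrt.congr fun L ↦ ?_
  simp only [Function.comp_apply]
  rw [Real.sqrt_div (Nat.cast_nonneg _), show Real.exp (2 * L) = Real.exp L ^ 2 by rw [← Real.exp_nat_mul]; ring_nf,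
    Real.sqrt_sq (Real.exp_pos L).le]

/-- **Thm 3, clause (i), PROVED**: `A_L / e^L → 4`. [cite: Chuk2026WeilWindows, Thm 3 and §1 (definition of `A_L`)] -/
theorem tendsto_weilCombMass_div_exp : Tendsto (fun L : ℝ ↦ weilCombMass L / Real.exp L) atTop (𝓝 4) := by
  have hS := tendsto_sum_vonMangoldt_div_sqrt.comp tendsto_weilWindowCutoff
  have hprod := (hS.mul tendsto_sqrt_weilWindowCutoff_div_exp).const_mul (2 : ℝ)
  rw [show (2 : ℝ) * (2 * 1) = 4 by norm_num] at hprod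
  refine hprod.congr' ?_
  filter_upwards [eventually_gt_atTop 0] with L hL
  simp only [Function.comp_apply]
  have hN1 : 1 ≤ weilWindowCutoff L := by
    unfold weilWindowCutoff
    have : 2 ≤ ⌈Real.exp (2 * L)⌉₊ := by
      have h1 : (1 : ℝ) < Real.exp (2 * L) := Real.one_lt_exp_iff.2 (by linarith)
      have : ((1 : ℕ) : ℝ) < Real.exp (2 * L) := by simpa using h1
      have := Nat.lt_ceil.2 this
      omega
    omega
  have hsN : 0 < Real.sqrt (weilWindowCutoff L : ℝ) := Real.sqrt_pos.2 (by exact_mod_cast hN1)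
  have hexp : 0 < Real.exp L := Real.exp_pos L
  rw [weilCombMass_eq, ← Finset.sum_mul]
  field_simp

/-! ### Clause (ii): the comb returns arbitrarily close to its mass `A_L` at arbitrarily large `t` -/

/-- **Lemma 6 (second half) / Thm 3, clause (ii), PROVED**: for every `L`, `ε > 0` and `T` there is `t ≥ T` with
`P_L(t) > A_L − ε` (Dirichlet's simultaneous approximation for `T' log n/(2π)`, `n ≤ N_L`).
[cite: Chuk2026WeilWindows, Lemma 6 and Thm 3] [cite: HardyWright2008, §11.12 Thm 200] -/
theorem exists_weilPrimeRipple_gt (L : ℝ) {ε : ℝ} (hε : 0 < ε) (T : ℝ) :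
    ∃ t : ℝ, T ≤ t ∧ weilCombMass L - ε < weilPrimeRipple (weilWindowCutoff L) t := by
  set N : ℕ := weilWindowCutoff L with hN_def
  set A : ℝ := weilCombMass L with hA_def
  have hA0 : 0 ≤ A := weilCombMass_nonneg L
  set T' : ℝ := max T 1 with hT'_def
  have hT'1 : 1 ≤ T' := le_max_right _ _
  have hT'0 : 0 < T' := by linarith
  -- the accuracy `Q`: `2π²(A+1)/Q < ε`, `Q ≥ 1`
  obtain ⟨Q, hQ⟩ : ∃ Q : ℕ, 2 * π ^ 2 * (A + 1) / ε < Q := exists_nat_gt _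
  have hπ := Real.pi_pos
  have hQpos : (0 : ℝ) < Q := lt_trans (by positivity) hQ
  have hQ1 : 1 ≤ Q := by exact_mod_cast (show (0 : ℝ) < Q from hQpos)
  have hQε : 2 * π ^ 2 * (A + 1) / (Q : ℝ) ^ 2 < ε := by
    have h1 : 2 * π ^ 2 * (A + 1) / (Q : ℝ) < ε := by
      rw [div_lt_iff₀ hQpos]
      rw [div_lt_iff₀ hε] at hQ
      linarith
    have hQ1' : (1 : ℝ) ≤ Q := by exact_mod_cast hQ1
    calc 2 * π ^ 2 * (A + 1) / (Q : ℝ) ^ 2 ≤ 2 * π ^ 2 * (A + 1) / (Q : ℝ) := by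
          rw [div_le_div_iff₀ (by positivity) hQpos]
          have : (0 : ℝ) ≤ 2 * π ^ 2 * (A + 1) := by positivity
          have hQQ : (Q : ℝ) ≤ (Q : ℝ) ^ 2 := by nlinarith
          exact mul_le_mul_of_nonneg_left hQQ this
      _ < ε := h1
  -- Dirichlet
  obtain ⟨q, p, hq1, -, hqp⟩ :=
    Literature.NumberTheory.DiophantineApproximation.exists_forall_abs_natCast_mul_sub_intCast_lt (K := ℝ)
      (fun i : Fin (N + 1) ↦ T' * Real.log ((i : ℕ) : ℝ) / (2 * π)) hQ1
  refine ⟨(q : ℝ) * T', ?_, ?_⟩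
  · have hq1' : (1 : ℝ) ≤ q := by exact_mod_cast hq1
    calc T ≤ T' := le_max_left _ _
      _ = 1 * T' := (one_mul _).symm
      _ ≤ (q : ℝ) * T' := mul_le_mul_of_nonneg_right hq1' hT'0.le
  · -- termwise: `cos(t log n) ≥ 1 − 2π²/Q²`
    have hcos : ∀ n ∈ Finset.range (N + 1),
        1 - 2 * π ^ 2 / (Q : ℝ) ^ 2 ≤ Real.cos ((q : ℝ) * T' * Real.log n) := by
      intro n hn
      have hlt : n < N + 1 := Finset.mem_range.1 hn
      set θ : ℝ := (q : ℝ) * (T' * Real.log ((n : ℕ) : ℝ) / (2 * π)) - (p ⟨n, hlt⟩ : ℝ) with hθ_def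
      have hθ : |θ| < 1 / (Q : ℝ) := hqp ⟨n, hlt⟩
      have harg : (q : ℝ) * T' * Real.log n = 2 * π * θ + (p ⟨n, hlt⟩ : ℝ) * (2 * π) := by
        rw [hθ_def]
        field_simp
        ring
      rw [harg, Real.cos_add_int_mul_two_pi]
      have hb := Real.one_sub_sq_div_two_le_cos (x := 2 * π * θ)
      have hθ2 : (2 * π * θ) ^ 2 / 2 ≤ 2 * π ^ 2 / (Q : ℝ) ^ 2 := by
        have hθ' : |θ| ^ 2 ≤ (1 / (Q : ℝ)) ^ 2 := by
          exact pow_le_pow_left₀ (abs_nonneg θ) hθ.le 2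
        rw [sq_abs] at hθ'
        have : (2 * π * θ) ^ 2 / 2 = 2 * π ^ 2 * θ ^ 2 := by ring
        rw [this]
        have : 2 * π ^ 2 / (Q : ℝ) ^ 2 = 2 * π ^ 2 * (1 / (Q : ℝ)) ^ 2 := by
          field_simp
        rw [this]
        exact mul_le_mul_of_nonneg_left hθ' (by positivity)
      linarith
    -- sum up
    have hsum : A * (1 - 2 * π ^ 2 / (Q : ℝ) ^ 2) ≤ weilPrimeRipple N ((q : ℝ) * T') := by
      rw [hA_def, weilCombMass_eq, Finset.sum_mul]
      unfold weilPrimeRipple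
      refine Finset.sum_le_sum fun n hn ↦ ?_
      have hw : 0 ≤ (Λ n : ℝ) / Real.sqrt n := div_nonneg ArithmeticFunction.vonMangoldt_nonneg (Real.sqrt_nonneg _)
      have := hcos n hn
      calc (Λ n : ℝ) / Real.sqrt n * 2 * (1 - 2 * π ^ 2 / (Q : ℝ) ^ 2)
          = (Λ n : ℝ) / Real.sqrt n * (2 * (1 - 2 * π ^ 2 / (Q : ℝ) ^ 2)) := by ring
        _ ≤ (Λ n : ℝ) / Real.sqrt n * (2 * Real.cos ((q : ℝ) * T' * Real.log n)) := by
          refine mul_le_mul_of_nonneg_left ?_ hw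
          linarith
    have hAQ : A * (2 * π ^ 2 / (Q : ℝ) ^ 2) ≤ 2 * π ^ 2 * (A + 1) / (Q : ℝ) ^ 2 := by
      rw [mul_div_assoc']
      rw [div_le_div_iff₀ (by positivity) (by positivity)]
      have hQ2 : 0 < (Q : ℝ) ^ 2 := by positivity
      nlinarith
    calc A - ε < A - 2 * π ^ 2 * (A + 1) / (Q : ℝ) ^ 2 := by linarith
      _ ≤ A * (1 - 2 * π ^ 2 / (Q : ℝ) ^ 2) := by rw [mul_sub, mul_one]; linarith
      _ ≤ weilPrimeRipple N ((q : ℝ) * T') := hsum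

end Chuk2026Thm3

/-! ## Theorem 3 (the two asymptotic clauses), discharged -/

/-- **Chuk 2026, Thm 3 (Barrier) / Lemma 6 — the asymptotic clauses, PROVED**: discharge of the named fact `Chuk2026_thm3`
(«`A_L = (4 + o(1)) e^L` as `L → ∞` by the prime number theorem» and «the supremum [`A_L` of the prime comb] is approached at
arbitrarily large `t`»): `Chuk2026Thm3.tendsto_weilCombMass_div_exp` (PNT by partial summation against `1/√n`) and
`Chuk2026Thm3.exists_weilPrimeRipple_gt` (Dirichlet's simultaneous approximation). RH-FREE.
[cite: Chuk2026WeilWindows, Thm 3 and Lemma 6] -/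
theorem Chuk2026_thm3_holds : Chuk2026_thm3 :=
  ⟨Chuk2026Thm3.tendsto_weilCombMass_div_exp, fun L _ε hε T ↦ Chuk2026Thm3.exists_weilPrimeRipple_gt L hε T⟩

end Literature.NumberTheory.LFunctions

end
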